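import Summits.Ventures.Crystal3D.Theorems.StickyWulffConstantCoaxialWallLawDebtTwinRow
import Summits.Ventures.Crystal3D.Theorems.StickyWulffConstantCoaxialWallLawDebtFaultRow
import Summits.Ventures.Crystal3D.Theorems.StickyWulffConstantCoaxialWallLawVicinalReachCoreCapstone
import Summits.Ventures.Crystal3D.Theorems.StickyWulffConstantCoaxialWallLawEndRowDefs
import HarnessLib

/-!
# The REACH core from the two census rows alone: R3 is class (C) (crux `CoaxialWallLaw`, stmt-Ventures-19481,
# line `WallLedgerF`)

HONEST FRAMING. Venture `Summits/Ventures/Crystal3D` (cell `crystal3d-full`), helper `--supports` the crux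
`CoaxialWallLaw` of `route-Ventures-StickyWulffConstant` (REGISTERED line `WallLedgerF`, open stub
`stub_coaxialTwoSlabAdhesion`).  Rung credit; F-C1 not moved; CONDITIONAL on named facts (the two census rows of
`…EndRowDefs`, `KissingGap δ`, `KissingClassification δ`).  19481-p2 g7.

19481-p1 g11's capstone of record `coaxialWallLaw_of_endRows_reach` (`…EndRowsReachCapstone`) carries, besides the two
census rows, the reach-registered DEEP debt R3 `CoaxialTwoSlabAdhesionReachIncoherentDeep` (`…VicinalReachCore`:
triadic offsets of level `3^{-j}`, `j ≥ 2`, registered for every admissible walker vertical; numerically six level-1/9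
classes of one cyclic 9-tower for 3 % of wall normals).  THIS FILE REMOVES R3: it is paid by the SAME in-plane
translation row `EndRowTrans v1 s_F` that pays R2, because every reach-registered translation pair is CLASS (C).

The argument (`cube_of_reach_translation`).  Let `τ = A₁⁻¹(t₂ − t₁) ∉ Λ₀` be the offset of a reach-registered
translation pair, `3^{j₀} τ ∈ Λ₀` with `j₀ ≥ 1` minimal, and `τ' = 3^{j₀−1} τ` (level ⅓ exactly).  Reach registration is
a GROUP condition (`reachSet = A₁·Λ₀ + t₁ + reachGroup`), so `A₁ τ'` lies in the reach group of `chainFrames z A₁ u` for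
every admissible `(z, u)`; CHAIN TORSION (`reachGroup_chainFrames_torsion`, 19481-p1 g10) puts `τ'` in the two fault
cosets of the planes through `u`, for every wide slot `u` (tilted vertical, `exists_tilt_vertical_wide`) — i.e. the
ANCESTOR pair `(A₁, t₁, A₂, t₁ + 3^{j₀−1}(t₂ − t₁))` is a VICINAL level-⅓ translation pair, hence a COHERENT basal FAULT
(`coherentFaultPair_of_vicinal_level_third`, 19481-p1 g11), hence class (C) for the fault plane's cube vertex
(`cube_of_coherentFault`, 19481-p2 g6); and class (C) is INHERITED from `3^{j₀−1} τ` to `τ` (an integer relation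
`ε_k p_k + ε_i p_i ∈ ℤ` for `τ` would survive multiplication by `3^{j₀−1}`).  Then `coaxialTwoSlabAdhesion_trans_skew_row`
gives the stub's conclusion at `(√6/s_F)·sin θ' ≥ ½·sin θ'` for the skew frame.  Twins (reach-registered or not) are the
twin row's (`coaxialTwoSlabAdhesion_general_twin_of_row`).

* `cube_of_smul_cube` (inheritance), `cube_of_reach_translation`,
  `coaxialTwoSlabAdhesionOn_reachTranslation_of_row`, `coaxialTwoSlabAdhesionOn_twin_of_halfTurnRow`,
  **`coaxialTwoSlabAdhesionReach_of_twoRows`** (`KissingGap δ → KissingClassification δ → 0 < s_F ≤ 2√6 →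
  EndRowTwinHalfTurn v1 s_F → EndRowTrans v1 s_F → CoaxialTwoSlabAdhesionReach`),
  `coaxialTwoSlabAdhesionReachIncoherentDeep_of_twoRows` (R3 BY NAME), `coaxialTwoSlabAdhesion_of_twoRows`,
  **`coaxialWallLaw_of_twoRows`** / `_p5_` : the crux BY NAME ⇐ {E1, `StarPairFar`, `KissingGap δ`,
  `KissingClassification δ`, `0 < s_F ≤ 2√6`, `EndRowTwinHalfTurn v1 s_F`, `EndRowTrans v1 s_F`} — NO incoherent / deep /
  (F-loc) hypothesis is left in lane F's debt list.
WHAT THIS IS NOT: a proof of either census row, of E1 or of `StarPairFar`; F-C1 not moved.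
-/

noncomputable section

namespace Summit.Ventures.Crystal3D.Theorems

open Summit.Ventures.Crystal3D Finset NearIdentity
open Summit.Ventures.Crystal3D.Cruxes.CoaxialWallLaw.WallLedgerF (CoaxialTwoSlabAdhesion)
open Literature.MathematicalPhysics.StatisticalMechanics (fccStacking barlowStacking IsHaggSeq constHagg
  isHaggSeq_const contactDeficiency)
open scoped InnerProductSpace

/-! ### Class (C) is inherited from an integer multiple -/

/-- **Inheritance of the cube condition.**  If no two signed cubic coordinates of `r • τ` (an integer `r`) sum to an
integer, then the same holds for `τ`. -/
theorem cube_of_smul_cube {τ : EuclideanSpace ℝ (Fin 3)} (r : ℤ) {c : Fin 8}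
    (h : ∀ k i : Fin 3, k ≠ i → ¬ ∃ z : ℤ,
      (cubeInt c k : ℝ) * (Real.sqrt 2 * cubicCoords ((r : ℝ) • τ) k) +
        (cubeInt c i : ℝ) * (Real.sqrt 2 * cubicCoords ((r : ℝ) • τ) i) = z) :
    ∀ k i : Fin 3, k ≠ i → ¬ ∃ z : ℤ,
      (cubeInt c k : ℝ) * (Real.sqrt 2 * cubicCoords τ k) + (cubeInt c i : ℝ) * (Real.sqrt 2 * cubicCoords τ i) = z := by
  intro k i hki ⟨z, hz⟩
  refine h k i hki ⟨r * z, ?_⟩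
  rw [cubicCoords_smul, Pi.smul_apply, Pi.smul_apply, smul_eq_mul, smul_eq_mul]
  push_cast
  linear_combination (r : ℝ) * hz

/-! ### Reach-registered translation pairs are class (C) -/

/-- **Every reach-registered translation pair is class (C).**  See the module docstring. -/
theorem cube_of_reach_translation
    (A₁ : EuclideanSpace ℝ (Fin 3) ≃ₗᵢ[ℝ] EuclideanSpace ℝ (Fin 3)) (t₁ : EuclideanSpace ℝ (Fin 3))
    (A₂ : EuclideanSpace ℝ (Fin 3) ≃ₗᵢ[ℝ] EuclideanSpace ℝ (Fin 3)) (t₂ : EuclideanSpace ℝ (Fin 3))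
    (hR : ReachPair A₁ t₁ A₂ t₂)
    (hΛ : A₂ '' fccStacking 1 (Real.sqrt (2 / 3)) = A₁ '' fccStacking 1 (Real.sqrt (2 / 3)))
    (hτ : A₁.symm (t₂ - t₁) ∉ fccStacking 1 (Real.sqrt (2 / 3))) :
    ∃ c : Fin 8, ∀ k i : Fin 3, k ≠ i → ¬ ∃ z : ℤ,
      (cubeInt c k : ℝ) * (Real.sqrt 2 * cubicCoords (A₁.symm (t₂ - t₁)) k) +
        (cubeInt c i : ℝ) * (Real.sqrt 2 * cubicCoords (A₁.symm (t₂ - t₁)) i) = z := by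
  classical
  set τ : EuclideanSpace ℝ (Fin 3) := A₁.symm (t₂ - t₁) with hτdef
  obtain ⟨⟨htri, -, -⟩, hreach⟩ := hR
  -- the minimal level `j₀ = k + 1` and the level-⅓ ancestor `τ' = 3^k τ`
  have hj₀ := Nat.find_spec htri
  have hj₀ne : Nat.find htri ≠ 0 := by
    intro h0
    rw [h0, pow_zero, one_smul] at hj₀
    exact hτ hj₀
  obtain ⟨k, hk⟩ := Nat.exists_eq_succ_of_ne_zero hj₀ne
  have hmin : (3 : ℝ) ^ k • τ ∉ fccStacking 1 (Real.sqrt (2 / 3)) := Nat.find_min htri (by omega)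
  rw [hk] at hj₀
  have h3τ' : (3 : ℝ) • ((3 : ℝ) ^ k • τ) ∈ fccStacking 1 (Real.sqrt (2 / 3)) := by
    rw [smul_smul, ← pow_succ']; exact hj₀
  -- the ancestor pair `(A₁, t₁, A₂, t₂')`
  set t₂' : EuclideanSpace ℝ (Fin 3) := t₁ + (3 : ℝ) ^ k • (t₂ - t₁) with ht₂'
  have hdiff : t₂' - t₁ = (3 : ℝ) ^ k • (t₂ - t₁) := by rw [ht₂']; abel
  have hτ'eq : A₁.symm (t₂' - t₁) = (3 : ℝ) ^ k • τ := by rw [hdiff, LinearIsometryEquiv.map_smul]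
  have h3anc : A₁.symm ((3 : ℝ) • (t₂' - t₁)) ∈ fccStacking 1 (Real.sqrt (2 / 3)) := by
    rw [LinearIsometryEquiv.map_smul, hτ'eq]; exact h3τ'
  -- the ancestor is a VICINAL pair: registered for every wide slot by chain torsion
  have hV' : VicinalPair A₁ t₁ A₂ t₂' := by
    refine ⟨⟨1, by rw [pow_one, hτ'eq]; exact h3τ'⟩, ?_, ?_⟩
    · intro ν hν hmenu htw
      exact absurd (hΛ.symm.trans htw) (image_ne_twinFrame A₁ hν hmenu)
    · intro _ m hm hmenum hadm u₁ hu₁ hup hdom n₁ hn₁ hmenu₁ hun _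
      obtain ⟨z, hz, hze, hsteep⟩ := exists_tilt_vertical_wide
        (by rw [LinearIsometryEquiv.norm_map, norm_eq_one_of_mem_fccSlots hu₁]) hup
      obtain ⟨y, hy, hy₂⟩ := hreach z hz hze u₁ hu₁ hsteep m hm hmenum hadm hdom
      obtain ⟨x₁, hx₁, v, hv, rfl⟩ := hy
      obtain ⟨x₂, hx₂, hyeq⟩ := hy₂
      have hA₂x₂ : A₂ x₂ ∈ A₁ '' fccStacking 1 (Real.sqrt (2 / 3)) := hΛ ▸ ⟨x₂, hx₂, rfl⟩
      obtain ⟨x₂', hx₂', hx₂'eq⟩ := hA₂x₂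
      -- `v = (t₂ − t₁) + A₁ x₂' − A₁ x₁`
      have hv_eq : v = (t₂ - t₁) + (A₁ x₂' - A₁ x₁) := by
        have : A₂ x₂ + t₂ = A₁ x₁ + t₁ + v := hyeq
        rw [← hx₂'eq] at this
        linear_combination (norm := module) (-1 : ℝ) • this
      have hmm : A₁.symm (A₁ x₂' - A₁ x₁) ∈ fccStacking 1 (Real.sqrt (2 / 3)) := by
        rw [map_sub, LinearIsometryEquiv.symm_apply_apply, LinearIsometryEquiv.symm_apply_apply]
        exact fcc_sub_site_mem hx₂' hx₁
      -- `v' = 3^k v` lies in the reach group and `3 v' ∈ A₁ Λ₀`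
      have hv' : (3 : ℝ) ^ k • v ∈ reachGroup (chainFrames z A₁ u₁) := by
        have e : (3 : ℝ) ^ k • v = (3 ^ k : ℕ) • v := by
          rw [← Nat.cast_smul_eq_nsmul ℝ]; push_cast; rfl
        rw [e]; exact AddSubgroup.nsmul_mem _ hv _
      have hv'_eq : (3 : ℝ) ^ k • v = (t₂' - t₁) + (((3 : ℤ) ^ k : ℤ) : ℝ) • (A₁ x₂' - A₁ x₁) := by
        rw [hdiff, hv_eq, smul_add]; push_cast; rfl
      have h3v' : A₁.symm ((3 : ℝ) • ((3 : ℝ) ^ k • v)) ∈ fccStacking 1 (Real.sqrt (2 / 3)) := by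
        rw [hv'_eq, smul_add, smul_comm, show (3 : ℝ) • (A₁ x₂' - A₁ x₁) = ((3 : ℤ) : ℝ) • (A₁ x₂' - A₁ x₁) by
          norm_num]
        exact symm_mem_fcc_add A₁ h3anc (symm_mem_fcc_zsmul A₁ _ (symm_mem_fcc_zsmul A₁ 3 hmm))
      obtain ⟨a, b, hab⟩ := reachGroup_chainFrames_torsion z A₁ hu₁ hn₁ hmenu₁ hun hv' h3v'
      refine ⟨a, b, ?_⟩
      have e : t₂' - t₁ - (a : ℝ) • (Real.sqrt (2 / 3) • n₁) -
          (b : ℝ) • (Real.sqrt (2 / 3) • ((2 * Real.sqrt (2 / 3)) • A₁ u₁ - n₁)) =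
          ((3 : ℝ) ^ k • v - (a : ℝ) • (Real.sqrt (2 / 3) • n₁) -
            (b : ℝ) • (Real.sqrt (2 / 3) • ((2 * Real.sqrt (2 / 3)) • A₁ u₁ - n₁))) -
          (((3 : ℤ) ^ k : ℤ) : ℝ) • (A₁ x₂' - A₁ x₁) := by
        rw [hv'_eq]; abel
      rw [e]
      exact symm_mem_fcc_sub A₁ hab (symm_mem_fcc_zsmul A₁ _ hmm)
  -- hence a COHERENT FAULT, hence class (C) for the fault plane's cube vertex, inherited by `τ`
  obtain ⟨-, n, hn1, hmenu, a, ha⟩ := coherentFaultPair_of_vicinal_level_third A₁ t₁ A₂ t₂' hV' hΛ h3anc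
  set μ : EuclideanSpace ℝ (Fin 3) := A₁.symm n with hμ
  have hAμ : A₁ μ = n := A₁.apply_symm_apply n
  have hμ1 : ‖μ‖ = 1 := by rw [hμ, LinearIsometryEquiv.norm_map, hn1]
  have hμmenu : ∀ w ∈ fccSlots, ⟪w, μ⟫_ℝ = 0 ∨ ⟪w, μ⟫_ℝ = Real.sqrt (2 / 3) ∨ ⟪w, μ⟫_ℝ = -Real.sqrt (2 / 3) := by
    intro w hw
    have := hmenu w hw
    rwa [← hAμ, LinearIsometryEquiv.inner_map_map] at this
  have ha' : (3 : ℝ) ^ k • τ - (a : ℝ) • (Real.sqrt (2 / 3) • μ) ∈ fccStacking 1 (Real.sqrt (2 / 3)) := by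
    have e : A₁.symm (t₂' - t₁ - (a : ℝ) • (Real.sqrt (2 / 3) • n)) = (3 : ℝ) ^ k • τ - (a : ℝ) • (Real.sqrt (2 / 3) • μ) := by
      rw [map_sub, hτ'eq, LinearIsometryEquiv.map_smul, LinearIsometryEquiv.map_smul]
    rw [← e]; exact ha
  obtain ⟨c, hcube⟩ := cube_of_coherentFault hμ1 hμmenu ha' hmin
  refine ⟨c, cube_of_smul_cube ((3 : ℤ) ^ k) ?_⟩
  have e : (((3 : ℤ) ^ k : ℤ) : ℝ) • τ = (3 : ℝ) ^ k • τ := by push_cast; rfl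
  rw [e]; exact hcube

/-! ### The reach core from the two rows -/

section Rows

variable {δ : ℝ} (hg : KissingGap δ) (hc : KissingClassification δ)
variable {sF : ℝ} (hsF : 0 < sF) (hsF' : sF ≤ 2 * Real.sqrt 6)

section Trans

variable (hrowT : EndRowTrans WordVersion.v1 sF)
include hg hc hsF hsF' hrowT

open scoped Classical in
/-- **Reach-registered TRANSLATION pairs from the in-plane translation row** (they are class (C)). -/
theorem coaxialTwoSlabAdhesionOn_reachTranslation_of_row :
    CoaxialTwoSlabAdhesionOn fun A₁ t₁ A₂ t₂ =>
      ReachPair A₁ t₁ A₂ t₂ ∧ A₂ '' fccStacking 1 (Real.sqrt (2 / 3)) = A₁ '' fccStacking 1 (Real.sqrt (2 / 3)) := by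
  intro A₁ t₁ A₂ t₂ _ hne hS
  obtain ⟨hR, hΛ₂⟩ := hS
  have htrans : A₁ '' fccStacking 1 (Real.sqrt (2 / 3)) = A₂ '' fccStacking 1 (Real.sqrt (2 / 3)) := hΛ₂.symm
  set e₃ : EuclideanSpace ℝ (Fin 3) := EuclideanSpace.single (2 : Fin 3) (1 : ℝ) with he₃
  set τ : EuclideanSpace ℝ (Fin 3) := A₁.symm (t₂ - t₁) with hτ
  have hτΛ : τ ∉ fccStacking 1 (Real.sqrt (2 / 3)) := offset_notMem_of_ne A₁ A₂ t₁ t₂ htrans hne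
  obtain ⟨c, hcube⟩ := cube_of_reach_translation A₁ t₁ A₂ t₂ hR hΛ₂ hτΛ
  obtain ⟨L', hL', hskew⟩ := exists_skewFrame_of_cube A₁ τ c hcube
  obtain ⟨C, R₀, hR₀, hmain⟩ := coaxialTwoSlabAdhesion_trans_skew_row hg hc A₁ t₁ A₂ t₂ L' hL' htrans hskew hsF
    (hrowT L')
  refine ⟨L', t₁, t₂, constHagg, constHagg, isHaggSeq_const, isHaggSeq_const,
    movedFcc_subset_frame_of_image_eq A₁ L' t₁ hL'.symm,
    movedFcc_subset_frame_of_image_eq A₂ L' t₂ (hΛ₂.trans hL'.symm), C, R₀, hR₀, ?_⟩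
  intro h hh ρ hρ X P₁ P₂ hX hP₁X hP₂X₁ hcyl hP₁ hP₂
  have key := hmain h hh ρ hρ X P₁ P₂ hX hP₁X hP₂X₁ hcyl hP₁ hP₂
  have hhalf : (1 / 2 : ℝ) * Real.sqrt (1 - ⟪L' e₃, e₃⟫_ℝ ^ 2) ≤ Real.sqrt 6 / sF * Real.sqrt (1 - ⟪L' e₃, e₃⟫_ℝ ^ 2) := by
    refine mul_le_mul_of_nonneg_right ?_ (Real.sqrt_nonneg _)
    rw [le_div_iff₀ hsF]
    linarith only [hsF']
  have hπρ : 0 ≤ Real.pi * ρ ^ 2 := by positivity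
  have := mul_le_mul_of_nonneg_right hhalf hπρ
  linarith only [key, this]

end Trans

section Twin

variable (hrowW : EndRowTwinHalfTurn WordVersion.v1 sF)
include hg hc hsF hsF' hrowW

open scoped Classical in
/-- **ALL twin pairs (`A₁·Λ₀ ≠ A₂·Λ₀`) from the twin half-turn row.** -/
theorem coaxialTwoSlabAdhesionOn_twin_of_halfTurnRow :
    CoaxialTwoSlabAdhesionOn fun A₁ _ A₂ _ =>
      A₁ '' fccStacking 1 (Real.sqrt (2 / 3)) ≠ A₂ '' fccStacking 1 (Real.sqrt (2 / 3)) := by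
  intro A₁ t₁ A₂ t₂ hcoax _ htwin
  obtain ⟨L, s₁, s₂, σ, σ', hσ, hσ', hsub₁, hsub₂⟩ := hcoax
  set e₃ : EuclideanSpace ℝ (Fin 3) := EuclideanSpace.single (2 : Fin 3) (1 : ℝ) with he₃
  have hRR : ∀ L' : EuclideanSpace ℝ (Fin 3) ≃ₗᵢ[ℝ] EuclideanSpace ℝ (Fin 3),
      ((ℝ ∙ e₃).reflection).trans (((ℝ ∙ e₃).reflection).trans L') = L' := fun L' =>
    LinearIsometryEquiv.ext fun x => by
      simp only [LinearIsometryEquiv.trans_apply, Submodule.reflection_reflection]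
  have hrow : ∀ F : Bool → (EuclideanSpace ℝ (Fin 3) ≃ₗᵢ[ℝ] EuclideanSpace ℝ (Fin 3)),
      (F false = L ∧ F true = ((ℝ ∙ e₃).reflection).trans L ∨
        F false = ((ℝ ∙ e₃).reflection).trans L ∧ F true = L) →
      LocalEndRow WordVersion.v1 sF ⟨F false, inPlaneRoots (F false) 1⟩ ⟨F true, inPlaneRoots (F true) (-1)⟩ := by
    rintro F (⟨h0, h1⟩ | ⟨h0, h1⟩)
    · rw [h0, h1]; exact hrowW L
    · have := hrowW (((ℝ ∙ e₃).reflection).trans L)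
      rw [hRR] at this
      rw [h0, h1]; exact this
  obtain ⟨C, R₀, hR₀, hmain⟩ := coaxialTwoSlabAdhesion_general_twin_of_row hg hc A₁ t₁ A₂ t₂ L s₁ s₂ σ σ'
    hσ hσ' hsub₁ hsub₂ htwin hsF hsF' hrow
  exact ⟨L, s₁, s₂, σ, σ', hσ, hσ', hsub₁, hsub₂, C, R₀, hR₀, hmain⟩

end Twin

variable (hrowW : EndRowTwinHalfTurn WordVersion.v1 sF) (hrowT : EndRowTrans WordVersion.v1 sF)
include hg hc hsF hsF' hrowW hrowT

/-- **THE REACH CORE FROM THE TWO CENSUS ROWS.**  See the module docstring. -/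
theorem coaxialTwoSlabAdhesionReach_of_twoRows : CoaxialTwoSlabAdhesionReach := by
  intro A₁ t₁ A₂ t₂ hco hne hR
  by_cases hΛ : A₂ '' fccStacking 1 (Real.sqrt (2 / 3)) = A₁ '' fccStacking 1 (Real.sqrt (2 / 3))
  · exact coaxialTwoSlabAdhesionOn_reachTranslation_of_row hg hc hsF hsF' hrowT A₁ t₁ A₂ t₂ hco hne ⟨hR, hΛ⟩
  · exact coaxialTwoSlabAdhesionOn_twin_of_halfTurnRow hg hc hsF hsF' hrowW A₁ t₁ A₂ t₂ hco hne (Ne.symm hΛ)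

/-- **R3 BY NAME**: the reach-registered deep debt `CoaxialTwoSlabAdhesionReachIncoherentDeep` from the two rows. -/
theorem coaxialTwoSlabAdhesionReachIncoherentDeep_of_twoRows : CoaxialTwoSlabAdhesionReachIncoherentDeep :=
  (split_of_coaxialTwoSlabAdhesionReach (coaxialTwoSlabAdhesionReach_of_twoRows hg hc hsF hsF' hrowW hrowT)).2.2

/-- R1 and R2 BY NAME as well (for the record; R1/R2 were already the rows' by `…DebtTwinRow` / `…DebtFaultRow`). -/
theorem reachDebts_of_twoRows :
    CoaxialTwoSlabAdhesionReachCoherentTwin ∧ CoaxialTwoSlabAdhesionReachCoherentFault ∧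
      CoaxialTwoSlabAdhesionReachIncoherentDeep :=
  split_of_coaxialTwoSlabAdhesionReach (coaxialTwoSlabAdhesionReach_of_twoRows hg hc hsF hsF' hrowW hrowT)

open scoped Classical in
/-- **The registered stub `stub_coaxialTwoSlabAdhesion` IN FULL from E1, `StarPairFar` and the two census rows.** -/
theorem coaxialTwoSlabAdhesion_of_twoRows
    {s₀ : EuclideanSpace ℝ (Fin 3)} (hs₀ : s₀ ∈ fccSlots)
    (hcert : ExactOnly 0 (fccSlots.filter fun w => 0 < ⟪w, s₀⟫_ℝ)) (hSP : StarPairFar) :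
    CoaxialTwoSlabAdhesion :=
  coaxialTwoSlabAdhesion_of_reach hs₀ hcert hSP (coaxialTwoSlabAdhesionReach_of_twoRows hg hc hsF hsF' hrowW hrowT)

open scoped Classical in
/-- **THE CRUX `CoaxialWallLaw` BY NAME FROM E1, `StarPairFar` AND THE TWO CENSUS ROWS** — no incoherent, deep or
(F-loc) hypothesis remains. -/
theorem coaxialWallLaw_of_twoRows
    {s₀ : EuclideanSpace ℝ (Fin 3)} (hs₀ : s₀ ∈ fccSlots)
    (hcert : ExactOnly 0 (fccSlots.filter fun w => 0 < ⟪w, s₀⟫_ℝ)) (hSP : StarPairFar) :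
    Summit.Ventures.Crystal3D.Theses.StickyWulffConstant.CoaxialWallLaw :=
  coaxialWallLaw_of_reach hs₀ hcert hSP (coaxialTwoSlabAdhesionReach_of_twoRows hg hc hsF hsF' hrowW hrowT)

/-- The same from `P5Exhaustion` (E1 as the certified computation). -/
theorem coaxialWallLaw_of_twoRows_p5 (hE1 : P5Exhaustion) (hSP : StarPairFar) :
    Summit.Ventures.Crystal3D.Theses.StickyWulffConstant.CoaxialWallLaw := by
  obtain ⟨s₀, hs₀, hcert⟩ := exactOnly_star_of_p5Exhaustion hE1
  exact coaxialWallLaw_of_twoRows hg hc hsF hsF' hrowW hrowT hs₀ hcert hSP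

end Rows

end Summit.Ventures.Crystal3D.Theorems

end
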